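import Literature.NumberTheory.GaloisRepresentations.RootsOfUnityInverseLimit
import Literature.NumberTheory.GaloisRepresentations.GaloisCohomologyKummerProofs
import Mathlib.Topology.Algebra.Category.ProfiniteGrp.Completion
import HarnessLib

/-!
# `H¹(G_K, Ẑ(1)) ≅ lim_n Kˣ/(Kˣ)ⁿ = (Kˣ)^∧`: Kummer theory in the inverse limit

Serre, *Galois Cohomology* II §1.2 / *Local Fields* XIV: the Kummer isomorphisms
`δ_n : Kˣ/(Kˣ)ⁿ ⥲ H¹(G_K, μ_n)` (tree: `kummerMap`, `kummerLift`, `kummerLift_bijective`,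
abc-iut / `GaloisCohomologyKummerProofs.lean`) are COMPATIBLE with the power maps `μ_m ↠ μ_n` and the
projections `Kˣ/(Kˣ)ᵐ ↠ Kˣ/(Kˣ)ⁿ` (`n ∣ m`), hence pass to the inverse limit
([AbsTopIII] Cor. 1.10 (i)(b) p. 42: "`H¹(G_k, μ_Ẑ(G_k)) ⥲ G_k^ab`" is Kummer theory
`H¹(G_k, Ẑ(1)) = (kˣ)^∧` followed by local class field theory `(kˣ)^∧ ⥲ G_k^ab`).  This file proves:

* `kummerMap_red_compat` — `H¹(μ_m ↠ μ_n) ∘ δ_m = δ_n` on `Kˣ` (any field of characteristic `0`);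
* `PowCompletion.*` — bookkeeping for the profinite completion `Â` (Mathlib's
  `ProfiniteGrp.ProfiniteCompletion.completion`) of a commutative group `A` all of whose power
  subgroups `Aⁿ` have finite index: an element of `Â` is determined by, and freely prescribed by, a
  family of classes in `A/Aⁿ` compatible along divisibility (every finite-index `H` contains
  `A^{[A:H]}`) — the presentation `Â = lim_n A/Aⁿ` [RibesZalesskii2010, Thm 2.7.1];
* `completionUnitsEquivCohomologyLimitMu` — for a field `K` of characteristic `0` with all `Kˣ/(Kˣ)ⁿ`
  finite (e.g. a `p`-adic local field, tree `finite_quotient_range_powMonoidHom_units`):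
  **`(Kˣ)^∧ ≃* Multiplicative (lim_n H¹(G_K, μ_n))`**, levelwise the Kummer isomorphisms; with
  `continuousCohomologyOneTateModuleEquiv` (NSW II §7 Thm. 2.7.5 in degree `1`,
  `RootsOfUnityInverseLimit.lean`): `H¹_cont(G_K, Ẑ(1)) ≃+ Additive (Kˣ)^∧`
  (`continuousCohomologyOneTateModuleEquivCompletion`).

Definitions with bodies and theorems; no named fact, no `sorry`.  Cell abc-iut, layer L4 (LCFT lane,
towards F-0347 `AbsTopIII.Cor_1_10_i_b`).
-/

noncomputable section

open CategoryTheory Function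
open ProfiniteGrp ProfiniteGrp.ProfiniteCompletion

universe u

namespace Literature.NumberTheory.GaloisRepresentations

open _root_.TopRep _root_.ContRepresentation _root_.ContinuousCohomology DiscreteGaloisModule

/-! ### Power subgroups of a commutative group and its profinite completion -/

namespace PowCompletion

variable {A : Type u} [CommGroup A]

/-- `Aᵐ ⊆ Aⁿ` for `n ∣ m`. [cite: RibesZalesskii2010, Thm 2.7.1] -/
theorem range_pow_le_of_dvd {n m : ℕ} (h : n ∣ m) :
    (powMonoidHom m : A →* A).range ≤ (powMonoidHom n : A →* A).range := by
  rintro _ ⟨a, rfl⟩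
  obtain ⟨d, rfl⟩ := h
  exact ⟨a ^ d, by rw [powMonoidHom_apply, powMonoidHom_apply, ← pow_mul, mul_comm]⟩

/-- `A^{[A:H]} ⊆ H` for a finite-index subgroup `H` (Lagrange). [cite: RibesZalesskii2010, Thm 2.7.1] -/
theorem range_pow_index_le (H : Subgroup A) [H.FiniteIndex] :
    (powMonoidHom H.index : A →* A).range ≤ H := by
  rintro _ ⟨a, rfl⟩
  exact Subgroup.pow_index_mem H a

variable (hfin : ∀ n : ℕ+, ((powMonoidHom (n : ℕ) : A →* A).range).FiniteIndex)

/-- `Aⁿ` as a finite-index normal subgroup (an index of Mathlib's finite-quotient diagram of `A`).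
[cite: RibesZalesskii2010, Thm 2.7.1] -/
@[reducible] def powLevel (n : ℕ+) : FiniteIndexNormalSubgroup A :=
  { toSubgroup := (powMonoidHom (n : ℕ) : A →* A).range
    isNormal' := inferInstance
    isFiniteIndex' := hfin n }

/-- The underlying subgroup of `powLevel n` is `Aⁿ`. [cite: RibesZalesskii2010, Thm 2.7.1] -/
@[simp] theorem powLevel_toSubgroup (n : ℕ+) :
    (powLevel hfin n).toSubgroup = (powMonoidHom (n : ℕ) : A →* A).range := rfl

/-- `powLevel` is antitone along divisibility. [cite: RibesZalesskii2010, Thm 2.7.1] -/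
theorem powLevel_le_of_dvd {n m : ℕ+} (h : (n : ℕ) ∣ m) : powLevel hfin m ≤ powLevel hfin n :=
  fun _ hx => range_pow_le_of_dvd h hx

/-- The index of a finite-index subgroup, as a positive natural number. [cite: RibesZalesskii2010, Thm 2.7.1] -/
def idx (H : FiniteIndexNormalSubgroup A) : ℕ+ :=
  ⟨H.toSubgroup.index, Nat.pos_of_ne_zero Subgroup.FiniteIndex.index_ne_zero⟩

/-- `A^{[A:H]} ≤ H`, in the language of `powLevel`. [cite: RibesZalesskii2010, Thm 2.7.1] -/
theorem powLevel_idx_le (H : FiniteIndexNormalSubgroup A) : powLevel hfin (idx H) ≤ H :=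
  fun _ hx => range_pow_index_le H.toSubgroup hx

/-- **The `A/Aⁿ`-component of an element of `Â`**, as a homomorphism `Â → A/Aⁿ`.
[cite: RibesZalesskii2010, Thm 2.7.1] -/
def proj (n : ℕ+) : completion (GrpCat.of A) →* A ⧸ (powMonoidHom (n : ℕ) : A →* A).range :=
  MonoidHom.mk' (fun x => x.val (powLevel hfin n)) fun _ _ => rfl

/-- Unfolding `proj`. [cite: RibesZalesskii2010, Thm 2.7.1] -/
theorem proj_apply (n : ℕ+) (x : completion (GrpCat.of A)) :
    proj hfin n x = x.val (powLevel hfin n) := rfl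

/-- The `H`-component of `x ∈ Â` is the image of its `A^{[A:H]}`-component.
[cite: RibesZalesskii2010, Thm 2.7.1] -/
theorem val_eq_map_proj (x : completion (GrpCat.of A)) (H : FiniteIndexNormalSubgroup A) :
    (x.val H : A ⧸ H.toSubgroup) =
      QuotientGroup.map _ H.toSubgroup (MonoidHom.id A) (powLevel_idx_le hfin H) (proj hfin (idx H) x) :=
  (x.prop (powLevel_idx_le hfin H).hom).symm

/-- Compatibility of the power components of `x ∈ Â` along divisibility. [cite: RibesZalesskii2010, Thm 2.7.1] -/
theorem map_proj (x : completion (GrpCat.of A)) {n m : ℕ+} (h : (n : ℕ) ∣ m) :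
    QuotientGroup.map _ _ (MonoidHom.id A) (range_pow_le_of_dvd h) (proj hfin m x) = proj hfin n x :=
  x.prop (powLevel_le_of_dvd hfin h).hom

/-- **An element of `Â` is determined by its components in the `A/Aⁿ`.** [cite: RibesZalesskii2010, Thm 2.7.1] -/
theorem ext_of_proj {x y : completion (GrpCat.of A)} (h : ∀ n : ℕ+, proj hfin n x = proj hfin n y) :
    x = y :=
  ProfiniteGrp.limit_ext _ x y fun H => by
    rw [val_eq_map_proj hfin x H, val_eq_map_proj hfin y H, h]

/-- **Every divisibility-compatible family of classes `c_n ∈ A/Aⁿ` is the family of power components of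
an element of `Â`** (put `x_H :=` the image of `c_{[A:H]}`). [cite: RibesZalesskii2010, Thm 2.7.1] -/
theorem exists_of_compatible (c : ∀ n : ℕ+, A ⧸ (powMonoidHom (n : ℕ) : A →* A).range)
    (hc : ∀ {n m : ℕ+} (h : (n : ℕ) ∣ m),
      QuotientGroup.map _ _ (MonoidHom.id A) (range_pow_le_of_dvd h) (c m) = c n) :
    ∃ x : completion (GrpCat.of A), ∀ n, proj hfin n x = c n := by
  refine ⟨⟨fun H => QuotientGroup.map _ H.toSubgroup (MonoidHom.id A) (powLevel_idx_le hfin H)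
      (c (idx H)), fun H K π => ?_⟩, fun n => ?_⟩
  · -- compatibility along `H ≤ K`: `[A:K] ∣ [A:H]`
    have hdvd : ((idx K : ℕ+) : ℕ) ∣ (idx H : ℕ+) := Subgroup.index_dvd_of_le π.le
    obtain ⟨a, ha⟩ := QuotientGroup.mk_surjective (c (idx H))
    have hK : c (idx K) = QuotientGroup.mk a := by rw [← hc hdvd, ← ha]; rfl
    change QuotientGroup.map H.toSubgroup K.toSubgroup (MonoidHom.id A) π.le
        (QuotientGroup.map _ H.toSubgroup (MonoidHom.id A) (powLevel_idx_le hfin H) (c (idx H))) =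
      QuotientGroup.map _ K.toSubgroup (MonoidHom.id A) (powLevel_idx_le hfin K) (c (idx K))
    rw [hK, ← ha]
    rfl
  · -- the `Aⁿ`-component: compare at the common multiple `n · [A:Aⁿ]`
    change QuotientGroup.map _ _ (MonoidHom.id A) (powLevel_idx_le hfin (powLevel hfin n))
      (c (idx (powLevel hfin n))) = c n
    set e : ℕ+ := idx (powLevel hfin n)
    obtain ⟨a, ha⟩ := QuotientGroup.mk_surjective (c (n * e))
    have he : c e = QuotientGroup.mk a := by
      rw [← hc (show ((e : ℕ+) : ℕ) ∣ (n * e : ℕ+) from ⟨n, by rw [PNat.mul_coe, mul_comm]⟩), ← ha]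
      rfl
    have hn : c n = QuotientGroup.mk a := by
      rw [← hc (show ((n : ℕ+) : ℕ) ∣ (n * e : ℕ+) from ⟨e, by rw [PNat.mul_coe]⟩), ← ha]
      rfl
    rw [he, hn]
    rfl

end PowCompletion

/-! ### The Kummer maps are compatible with the power maps -/

section Kummer

variable (K : Type u) [Field K] [CharZero K]

omit [CharZero K] in
/-- `αᵈ` is a Kummer unit of level `n` when `α` is one of level `n·d`-ish: precisely, for `n ∣ m` and
`α ∈ kummerUnits K m`, `α^{m/n} ∈ kummerUnits K n`. [cite: SerreGaloisCohomology1997, II §1.2] -/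
theorem pow_div_mem_kummerUnits {n m : ℕ} (h : n ∣ m) (α : kummerUnits K m) :
    (α : (AlgebraicClosure K)ˣ) ^ (m / n) ∈ kummerUnits K n := fun σ => by
  rw [← pow_mul, Nat.div_mul_cancel h]
  exact α.2 σ

/-- **`H¹(μ_m ↠ μ_n) ∘ δ_m = δ_n`**: the Kummer maps `kummerMap K n : Kˣ → H¹(G_K, μ_n)` are compatible
with the transition maps of the inverse system `(μ_n)_n` (`muSystem K`; on cocycles:
`(σ(α)/α)^{m/n} = σ(α^{m/n})/α^{m/n}` and `(α^{m/n})ⁿ = αᵐ = a`). [cite: SerreGaloisCohomology1997, II §1.2] -/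
theorem kummerMap_red_compat {n m : ℕ+} (h : (muSystem K).le n m) (a : Kˣ) :
    cohomologyMap ((muSystem K).redHom h) 1 (Multiplicative.toAdd (kummerMap K m a)) =
      Multiplicative.toAdd (kummerMap K n a) := by
  have hdvd : (n : ℕ) ∣ m := h
  set α : kummerUnits K m := kummerUnitsRoot K m a with hα
  let β : kummerUnits K n :=
    ⟨(α : (AlgebraicClosure K)ˣ) ^ ((m : ℕ) / n), pow_div_mem_kummerUnits K hdvd α⟩
  have hβ : kummerMap K n a = kummerClassHom K n β := by
    rw [kummerMap_apply]
    refine kummerClassHom_eq_of_pow_eq K n ?_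
    change _ = ((α : (AlgebraicClosure K)ˣ) ^ ((m : ℕ) / n)) ^ (n : ℕ)
    rw [← pow_mul, Nat.div_mul_cancel hdvd, kummerUnitsRoot_pow, hα, kummerUnitsRoot_pow]
  have hcoc : (muSystem K).redCocycle₁ h (kummerOneCocycle K m α) = kummerOneCocycle K n β := by
    refine Subtype.ext (ContinuousMap.ext fun σ => muVal_injective K n ?_)
    rw [DiscreteInvSystem.redCocycle₁_apply, muSystem_red, muVal_muPowMap, kummerOneCocycle_apply,
      kummerOneCocycle_apply, muVal_kummerOneCocycleFun, muVal_kummerOneCocycleFun, div_pow, smul_pow']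
  have h1 : cohomologyMap ((muSystem K).redHom h) 1 (oneCocycleClass (mu K m).toTopRep
      (kummerOneCocycle K m α)) = oneCocycleClass (mu K n).toTopRep
      ((muSystem K).redCocycle₁ h (kummerOneCocycle K m α)) :=
    (muSystem K).cohomologyMap_redHom_oneCocycleClass h _
  rw [hβ, kummerMap_apply, kummerClassHom_apply, kummerClassHom_apply, toAdd_ofAdd, toAdd_ofAdd, h1,
    hcoc]

/-- The Kummer isomorphism on quotients is compatible with the transition maps:
`H¹(μ_m ↠ μ_n) (kummerLift m q) = kummerLift n (q mod (Kˣ)ⁿ)`. [cite: SerreGaloisCohomology1997, II §1.2] -/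
theorem kummerLift_red_compat {n m : ℕ+} (h : (muSystem K).le n m) (a : Kˣ) :
    cohomologyMap ((muSystem K).redHom h) 1 (Multiplicative.toAdd (kummerLift K m (QuotientGroup.mk a))) =
      Multiplicative.toAdd (kummerLift K n (QuotientGroup.mk a)) :=
  kummerMap_red_compat K h a

end Kummer

/-! ### `(Kˣ)^∧ ≅ lim_n H¹(G_K, μ_n)` -/

section Completion

variable (K : Type u) [Field K] [CharZero K]
variable (hfin : ∀ n : ℕ+, ((powMonoidHom (n : ℕ) : Kˣ →* Kˣ).range).FiniteIndex)

/-- The Kummer classes of the power components of `x ∈ (Kˣ)^∧` are compatible.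
[cite: SerreGaloisCohomology1997, II §1.2] -/
theorem kummerLift_proj_compat (x : completion (GrpCat.of Kˣ)) {n m : ℕ+} (h : (muSystem K).le n m) :
    cohomologyMap ((muSystem K).redHom h) 1
        (Multiplicative.toAdd (kummerLift K m (PowCompletion.proj hfin m x))) =
      Multiplicative.toAdd (kummerLift K n (PowCompletion.proj hfin n x)) := by
  obtain ⟨a, ha⟩ := QuotientGroup.mk_surjective (PowCompletion.proj hfin m x)
  have hn : PowCompletion.proj hfin n x = QuotientGroup.mk a := by
    rw [← PowCompletion.map_proj hfin x h, ← ha]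
    rfl
  rw [hn, ← ha]
  exact kummerMap_red_compat K h a

/-- The family of Kummer classes of `x ∈ (Kˣ)^∧`, an element of `lim_n H¹(G_K, μ_n)`.
[cite: SerreGaloisCohomology1997, II §1.2] -/
def kummerCoords (x : completion (GrpCat.of Kˣ)) : (muSystem K).cohomologyLimit 1 :=
  ⟨fun n => Multiplicative.toAdd (kummerLift K n (PowCompletion.proj hfin n x)),
    fun _ _ h => kummerLift_proj_compat K hfin x h⟩

/-- Coordinates of `kummerCoords`. [cite: SerreGaloisCohomology1997, II §1.2] -/
@[simp] theorem coe_kummerCoords_apply (x : completion (GrpCat.of Kˣ)) (n : ℕ+) :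
    ((kummerCoords K hfin x : (muSystem K).cohomologyLimit 1) :
        ∀ n, continuousCohomology 1 ((muSystem K).ρ n).toTopRep) n =
      Multiplicative.toAdd (kummerLift K n (PowCompletion.proj hfin n x)) := rfl

/-- `kummerCoords` is multiplicative-to-additive. [cite: SerreGaloisCohomology1997, II §1.2] -/
theorem kummerCoords_mul (x y : completion (GrpCat.of Kˣ)) :
    kummerCoords K hfin (x * y) = kummerCoords K hfin x + kummerCoords K hfin y := by
  refine Subtype.ext (funext fun n => ?_)
  rw [AddSubgroup.coe_add, Pi.add_apply, coe_kummerCoords_apply, coe_kummerCoords_apply,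
    coe_kummerCoords_apply, map_mul, map_mul, toAdd_mul]

/-- **`(Kˣ)^∧ → lim_n H¹(G_K, μ_n)`**, levelwise the Kummer isomorphisms `Kˣ/(Kˣ)ⁿ ⥲ H¹(G_K, μ_n)`.
[cite: SerreGaloisCohomology1997, II §1.2] -/
def completionUnitsToCohomologyLimit :
    completion (GrpCat.of Kˣ) →* Multiplicative ((muSystem K).cohomologyLimit 1) :=
  MonoidHom.mk' (fun x => Multiplicative.ofAdd (kummerCoords K hfin x)) fun x y => by
    rw [kummerCoords_mul, ofAdd_add]

/-- Coordinates of `completionUnitsToCohomologyLimit`. [cite: SerreGaloisCohomology1997, II §1.2] -/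
theorem completionUnitsToCohomologyLimit_apply (x : completion (GrpCat.of Kˣ)) (n : ℕ+) :
    ((Multiplicative.toAdd (completionUnitsToCohomologyLimit K hfin x) :
        (muSystem K).cohomologyLimit 1) : ∀ n, continuousCohomology 1 ((muSystem K).ρ n).toTopRep) n =
      Multiplicative.toAdd (kummerLift K n (PowCompletion.proj hfin n x)) := rfl

/-- **`(Kˣ)^∧ → lim_n H¹(G_K, μ_n)` is bijective** (injective: an element of `(Kˣ)^∧` is determined by
its power components and each Kummer map is injective; surjective: the preimages of a compatible family
under the Kummer bijections are compatible, hence come from `(Kˣ)^∧`). [cite: SerreGaloisCohomology1997, II §1.2] -/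
theorem completionUnitsToCohomologyLimit_bijective :
    Bijective (completionUnitsToCohomologyLimit K hfin) := by
  constructor
  · refine (injective_iff_map_eq_one _).2 fun x hx => ?_
    refine PowCompletion.ext_of_proj hfin fun n => ?_
    have h := congrArg (fun z : Multiplicative ((muSystem K).cohomologyLimit 1) =>
      ((Multiplicative.toAdd z : (muSystem K).cohomologyLimit 1) :
        ∀ n, continuousCohomology 1 ((muSystem K).ρ n).toTopRep) n) hx
    have h1 : kummerLift K n (PowCompletion.proj hfin n x) = 1 := Multiplicative.toAdd.injective h
    rw [map_one]
    exact (kummerLift_bijective K n).1 (h1.trans (map_one _).symm)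
  · intro z
    choose c hc using fun n : ℕ+ => (kummerLift_bijective K n).2
      (Multiplicative.ofAdd (((Multiplicative.toAdd z : (muSystem K).cohomologyLimit 1) :
        ∀ n, continuousCohomology 1 ((muSystem K).ρ n).toTopRep) n))
    have hcompat : ∀ {n m : ℕ+} (h : (n : ℕ) ∣ m),
        QuotientGroup.map _ _ (MonoidHom.id _) (PowCompletion.range_pow_le_of_dvd h) (c m) = c n := by
      intro n m h
      obtain ⟨a, ha⟩ := QuotientGroup.mk_surjective (c m)
      apply (kummerLift_bijective K n).1
      apply Multiplicative.toAdd.injective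
      rw [hc, toAdd_ofAdd, ← ha]
      change Multiplicative.toAdd (kummerLift K n (QuotientGroup.mk a)) = _
      rw [← kummerLift_red_compat K (show (muSystem K).le n m from h) a, ha, hc, toAdd_ofAdd]
      exact (Multiplicative.toAdd z).2 h
    obtain ⟨x, hx⟩ := PowCompletion.exists_of_compatible hfin c hcompat
    refine ⟨x, Multiplicative.toAdd.injective (Subtype.ext (funext fun n => ?_))⟩
    rw [completionUnitsToCohomologyLimit_apply, hx, hc, toAdd_ofAdd]

/-- **`(Kˣ)^∧ ≃* Multiplicative (lim_n H¹(G_K, μ_n))`** for a field `K` of characteristic `0` with all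
`Kˣ/(Kˣ)ⁿ` finite. [cite: SerreGaloisCohomology1997, II §1.2] -/
def completionUnitsEquivCohomologyLimitMu :
    completion (GrpCat.of Kˣ) ≃* Multiplicative ((muSystem K).cohomologyLimit 1) :=
  MulEquiv.ofBijective _ (completionUnitsToCohomologyLimit_bijective K hfin)

/-- **`H¹_cont(G_K, Ẑ(1)) ≃+ Additive (Kˣ)^∧`** (NSW II §7 Thm. 2.7.5 in degree `1` + Kummer theory),
for a field `K` of characteristic `0` with all `Kˣ/(Kˣ)ⁿ` finite. [cite: NeukirchSchmidtWingberg2008, II §7 Thm 2.7.5] -/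
def continuousCohomologyOneTateModuleEquivCompletion :
    continuousCohomology 1 (tateModuleMu K).toTopRep ≃+ Additive (completion (GrpCat.of Kˣ)) :=
  (continuousCohomologyOneTateModuleEquiv K).trans
    { toFun := fun z => Additive.ofMul ((completionUnitsEquivCohomologyLimitMu K hfin).symm
        (Multiplicative.ofAdd z))
      invFun := fun x => Multiplicative.toAdd (completionUnitsEquivCohomologyLimitMu K hfin
        (Additive.toMul x))
      left_inv := fun z => by
        simp only [toMul_ofMul, MulEquiv.apply_symm_apply, toAdd_ofAdd]
      right_inv := fun x => by
        simp only [ofAdd_toAdd, MulEquiv.symm_apply_apply, ofMul_toMul]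
      map_add' := fun z w => by
        rw [← ofMul_mul, ← map_mul, ← ofAdd_add] }

end Completion

end Literature.NumberTheory.GaloisRepresentations
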